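import Mathlib
import Summits.NavierStokesRegularity.NavierStokesRegularity.Theorems.LerayQuarterDissipationFiniteDissipationLiouvilleWindowFastTimes
import Summits.NavierStokesRegularity.NavierStokesRegularity.Theorems.LerayQuarterDissipationFiniteDissipationLiouvilleWindowRecurrenceProduction
import Literature.Analysis.FluidPDE.TypeIAncientMildDecay
import HarnessLib

/-!
# Crux `FiniteDissipationLiouville` (stmt-NavierStokesRegularity-22144): THE STRETCHING EXCESS AND
# THE SUPER-CALORIC SET LIVE IN THE GRADIENT CORE — volume at every scale and temporal density

Theorems file of route `LerayQuarterDissipation` (lead prover g19; `--supports` the crux; sequel of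
`…WindowFastTimes`, `…WindowRecurrenceStretching`, `…WindowRecurrenceProduction`). Navier–Stokes
regularity is NOT proved by anything here; no summit is.

`…WindowFastTimes` converted the volume floor of the FAST set into a temporal density using the
confinement of fast points to the self-similar core (`‖x‖ < (A−1)√(−t)` under the envelope). The two
GRADIENT-level excesses are confined as well:

* `gradFast_of_superCaloric` — a strictly super-caloric point of `t²‖ω‖²`,
  `‖ω‖² < (−t)(⟪ω, ∇u ω⟫ − |∇ω|²_F)`, has `(−t)‖∇u‖ > 1`; `gradFast_of_stretching_excess` — a
  stretching-excess point, `|∇ω|²_F + ‖ω‖²/(4(−t)) < ⟪ω, ∇u ω⟫`, has `(−t)‖∇u‖ > ¼`;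
* `norm_lt_of_gradFast` — under the class-uniform gradient decay of the enveloped class
  (`(‖x‖ + √(−t))²‖∇u‖ ≤ K₁(A)`, Chae–Wolf (3.6), Literature `…exists_forall_pow_mul_norm_iteratedFDeriv_le_of_hasTypeIDecay`)
  a point with `(−t)‖∇u‖ > θ` has `‖x‖ < (√(K₁/θ) − 1)√(−t)`: THE GRADIENT CORE;
* **`stretching_excess_volume_scaled`**, **`superCaloric_volume_scaled`** — the volume floors
  `≥ η c⁵` in every window `[−c², −εc²]` (parabolic dilation, `…WindowVolumeScaling.volume_window_scaled`);
* **`stretchingTimes_measure_ge`** — for every `A` there are `ε(A) ∈ (0,1)`, `κ(A) > 0` such that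
  for every SINGULAR enveloped KNSS-gauge Type-I field and every `c > 0` the instants
  `t ∈ [−c², −εc²]` at which vortex stretching beats local palinstrophy plus the scaling quarter
  SOMEWHERE have Lebesgue measure `≥ κ c²`;
* **`superCaloricTimes_measure_ge`** — for every `A, K` there are `ε ∈ (0,1)`, `κ > 0` such that
  for every SINGULAR member of the stratum with a Type-I envelope (`IsTypeIAncientMild C V`, `C ≤ A`,
  `HasTypeIDecay A V`, law `K` — e.g. the critical element of the crux) and every `c > 0`, the
  instants `t ∈ [−c², −εc²]` at which `t²‖ω‖²` is somewhere strictly super-caloric have measure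
  `≥ κ c²`: **the enstrophy density of the hypothetical minimal blow-up profile is super-caloric
  somewhere for a definite FRACTION OF THE TIME, at every scale.**

HONEST FRAMING. Cavalieri bookkeeping on top of the compactness corollaries of this generation;
`ε, η, κ` ineffective; statements about a HYPOTHETICAL object. Nothing is removed from the DSS wall
(`∀ c>1 TypeIDSSLiouville c`, NECESSARY for the crux). Nothing here bears on NS regularity.

References: Koch–Nadirashvili–Seregin–Šverák, Acta Math. 203 (2009) §4; Chae–Wolf, arXiv:1610.09464
§3 (3.6); folklore.
-/

noncomputable section

set_option linter.dupNamespace false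

namespace Summit.NavierStokesRegularity.NavierStokesRegularity.Theorems.FiniteDissipationLiouville.WindowRecurrence

open MeasureTheory Set Filter Topology Metric InnerProductSpace Function Real
open scoped RealInnerProductSpace ContDiff ENNReal
open Literature.Analysis Literature.Analysis.FluidPDE
open Summit.NavierStokesRegularity.NavierStokesRegularity.Theorems
open Summit.NavierStokesRegularity.NavierStokesRegularity.Theorems.RecurrentReductionD
open Summit.NavierStokesRegularity.NavierStokesRegularity.Theorems.FiniteDissipationLiouville
open Summit.NavierStokesRegularity.NavierStokesRegularity.Theorems.FiniteDissipationLiouville.CrossFlow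
open Summit.NavierStokesRegularity.NavierStokesRegularity.Theorems.FiniteDissipationLiouville.WindowSocket

/-! ### Gradient-fast points and the gradient core -/

section GradientCore

/-- **A strictly super-caloric point is gradient-fast**: `‖ω‖² < (−s)(⟪ω, L ω⟫ − |G|²_F)` forces
`1 < (−s)‖L‖` (and `ω ≠ 0`). [folklore] -/
theorem gradFast_of_superCaloric {s : ℝ} (hs : s < 0) {w₀ : EuclideanSpace ℝ (Fin 3)}
    {L G : EuclideanSpace ℝ (Fin 3) →L[ℝ] EuclideanSpace ℝ (Fin 3)}
    (h : ⟪w₀, w₀⟫ < (-s) * (⟪w₀, L w₀⟫ - frobeniusNormSq G)) : 1 < (-s) * ‖L‖ := by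
  have hs' : 0 < -s := neg_pos.2 hs
  have hG : 0 ≤ frobeniusNormSq G :=
    Summit.NavierStokesRegularity.ForcedUniquenessCountableJunk.frobeniusNormSq_nonneg' G
  have h1 : ⟪w₀, L w₀⟫ ≤ ‖w₀‖ ^ 2 * ‖L‖ := by
    calc ⟪w₀, L w₀⟫ ≤ ‖w₀‖ * ‖L w₀‖ := real_inner_le_norm _ _
      _ ≤ ‖w₀‖ * (‖L‖ * ‖w₀‖) := mul_le_mul_of_nonneg_left (L.le_opNorm w₀) (norm_nonneg _)
      _ = ‖w₀‖ ^ 2 * ‖L‖ := by ring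
  rw [real_inner_self_eq_norm_sq] at h
  have h2 : ‖w₀‖ ^ 2 < (-s) * (‖w₀‖ ^ 2 * ‖L‖) := by nlinarith
  have hω : 0 < ‖w₀‖ ^ 2 := by
    rcases (sq_nonneg ‖w₀‖).eq_or_lt with h0 | h0
    · rw [← h0] at h2; simp at h2
    · exact h0
  by_contra hle
  push Not at hle
  nlinarith

/-- **A stretching-excess point is gradient-fast**: `|G|²_F + ‖ω‖²/(4(−t)) < ⟪ω, L ω⟫` forces
`¼ < (−t)‖L‖`. [folklore] -/
theorem gradFast_of_stretching_excess {t : ℝ} (ht : t < 0) {w₀ : EuclideanSpace ℝ (Fin 3)}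
    {L G : EuclideanSpace ℝ (Fin 3) →L[ℝ] EuclideanSpace ℝ (Fin 3)}
    (h : frobeniusNormSq G + ‖w₀‖ ^ 2 / (4 * (-t)) < ⟪w₀, L w₀⟫) : 1 / 4 < (-t) * ‖L‖ := by
  have ht' : 0 < -t := neg_pos.2 ht
  have hG : 0 ≤ frobeniusNormSq G :=
    Summit.NavierStokesRegularity.ForcedUniquenessCountableJunk.frobeniusNormSq_nonneg' G
  have h1 : ⟪w₀, L w₀⟫ ≤ ‖w₀‖ ^ 2 * ‖L‖ := by
    calc ⟪w₀, L w₀⟫ ≤ ‖w₀‖ * ‖L w₀‖ := real_inner_le_norm _ _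
      _ ≤ ‖w₀‖ * (‖L‖ * ‖w₀‖) := mul_le_mul_of_nonneg_left (L.le_opNorm w₀) (norm_nonneg _)
      _ = ‖w₀‖ ^ 2 * ‖L‖ := by ring
  have h2 : ‖w₀‖ ^ 2 / (4 * (-t)) < ‖w₀‖ ^ 2 * ‖L‖ := by linarith
  have hω : 0 < ‖w₀‖ ^ 2 := by
    rcases (sq_nonneg ‖w₀‖).eq_or_lt with h0 | h0
    · rw [← h0] at h2; simp at h2
    · exact h0
  rw [div_lt_iff₀ (by positivity)] at h2
  by_contra hle
  push Not at hle
  nlinarith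

/-- **The gradient core**: if `(‖x‖ + √(−t))²‖∇V(t,x)‖ ≤ K₁` and `θ < (−t)‖∇V(t,x)‖` with `θ > 0`,
then `‖x‖ < (√(K₁/θ) − 1)√(−t)`. [folklore] -/
theorem norm_lt_of_gradFast {K₁ θ t : ℝ} {x : EuclideanSpace ℝ (Fin 3)}
    {L : EuclideanSpace ℝ (Fin 3) →L[ℝ] EuclideanSpace ℝ (Fin 3)} (hθ : 0 < θ) (ht : t < 0)
    (hK : (‖x‖ + Real.sqrt (-t)) ^ (1 + 1) * ‖L‖ ≤ K₁) (h : θ < (-t) * ‖L‖) :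
    ‖x‖ < (Real.sqrt (K₁ / θ) - 1) * Real.sqrt (-t) := by
  have ht' : 0 < -t := neg_pos.2 ht
  have hs : 0 < Real.sqrt (-t) := Real.sqrt_pos.2 ht'
  have hss : Real.sqrt (-t) ^ 2 = -t := Real.sq_sqrt ht'.le
  set a : ℝ := ‖x‖ + Real.sqrt (-t) with ha
  have ha0 : 0 < a := by positivity
  have hLpos : 0 < ‖L‖ := by
    by_contra hle; push Not at hle; nlinarith
  -- `θ a² < (−t) a² ‖L‖ ≤ (−t) K₁`
  have h2 : a ^ 2 * ‖L‖ ≤ K₁ := by simpa [ha] using hK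
  have h1a : θ * a ^ 2 < (-t) * ‖L‖ * a ^ 2 := mul_lt_mul_of_pos_right h (pow_pos ha0 2)
  have h1b : (-t) * ‖L‖ * a ^ 2 ≤ K₁ * (-t) := by
    have := mul_le_mul_of_nonneg_left h2 ht'.le
    nlinarith
  have h1 : θ * a ^ 2 < K₁ * (-t) := h1a.trans_le h1b
  have hK₁ : 0 < K₁ := by nlinarith
  -- `a < √(K₁/θ) √(−t)`
  have h3 : a ^ 2 < (Real.sqrt (K₁ / θ) * Real.sqrt (-t)) ^ 2 := by
    rw [mul_pow, hss, Real.sq_sqrt (by positivity)]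
    rw [div_mul_eq_mul_div, lt_div_iff₀ hθ]
    linarith
  have hb0 : 0 ≤ Real.sqrt (K₁ / θ) * Real.sqrt (-t) := by positivity
  have h4 : a < Real.sqrt (K₁ / θ) * Real.sqrt (-t) := lt_of_pow_lt_pow_left₀ 2 hb0 h3
  have : ‖x‖ = a - Real.sqrt (-t) := by rw [ha]; ring
  rw [this]
  linarith

end GradientCore

/-! ### Volume at every scale -/

section Scaled

/-- **THE STRETCHING EXCESS HAS VOLUME `≥ η c⁵` IN EVERY WINDOW `[−c², −εc²]`.**
[folklore; cite: KochNadirashviliSereginSverak2009, §4 (arXiv:0709.3599 p. 8)] -/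
theorem stretching_excess_volume_scaled (A : ℝ) : ∃ ε : ℝ, 0 < ε ∧ ε < 1 ∧ ∃ η : ℝ, 0 < η ∧
    ∀ (C : ℝ) (V : ℝ → EuclideanSpace ℝ (Fin 3) → EuclideanSpace ℝ (Fin 3)),
      IsTypeIAncientMild C V → C ≤ A → HasTypeIDecay A V →
      (∀ r > 0, ∀ M : ℝ, ∃ t ∈ Ioo (-(r ^ 2)) (0 : ℝ),
        ∃ x ∈ ball (0 : EuclideanSpace ℝ (Fin 3)) r, M < ‖V t x‖) →
      ∀ c : ℝ, 0 < c →
      ENNReal.ofReal (η * c ^ 5) ≤ volume {p : ℝ × EuclideanSpace ℝ (Fin 3) |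
        p.1 ∈ Icc (-c ^ 2) (-(ε * c ^ 2)) ∧
        frobeniusNormSq (fderiv ℝ (curl (V p.1)) p.2) + ‖curl (V p.1) p.2‖ ^ 2 / (4 * (-p.1)) <
          ⟪curl (V p.1) p.2, fderiv ℝ (V p.1) p.2 (curl (V p.1) p.2)⟫} := by
  obtain ⟨ε, hε, hε1, η, hη, h⟩ := stretching_excess_volume A
  refine ⟨ε, hε, hε1, η, hη, fun C V hV hCA hdec hsing c hc => ?_⟩
  have h1 := h C (nsRescale c V) (hV.nsRescale hc) hCA (hdec.nsRescale hc)
    (singularAtOrigin_nsRescale hsing hc)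
  have h2 := volume_window_scaled
    (G := fun F t x => ⟪curl (F t) x, fderiv ℝ (F t) x (curl (F t) x)⟫ ≤
      frobeniusNormSq (fderiv ℝ (curl (F t)) x) + ‖curl (F t) x‖ ^ 2 / (4 * (-t)))
    (fun F c' t x hc' ht hG => stretchingBalance_at_nsRescale F x hc' ht hG) hε hc (V := V) (η := η)
    (h1.trans (measure_mono fun p hp => ⟨hp.1, not_le.2 hp.2⟩))
  exact h2.trans (measure_mono fun p hp => ⟨hp.1, not_le.1 hp.2⟩)

/-- **THE SUPER-CALORIC SET HAS VOLUME `≥ η c⁵` IN EVERY WINDOW `[−c², −εc²]` (crux frame).**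
[folklore; cite: KochNadirashviliSereginSverak2009, §4 (arXiv:0709.3599 p. 8)] -/
theorem superCaloric_volume_scaled (C K : ℝ) : ∃ ε : ℝ, 0 < ε ∧ ε < 1 ∧ ∃ η : ℝ, 0 < η ∧
    ∀ (V : ℝ → EuclideanSpace ℝ (Fin 3) → EuclideanSpace ℝ (Fin 3)), IsTypeIAncientMild C V →
      (∀ s : ℝ, s < 0 → ∫⁻ x, ‖fderiv ℝ (V s) x‖ₑ ^ 2 ≤ ENNReal.ofReal (K / Real.sqrt (-s))) →
      (∀ r > 0, ∀ M : ℝ, ∃ t ∈ Ioo (-(r ^ 2)) (0 : ℝ),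
        ∃ x ∈ ball (0 : EuclideanSpace ℝ (Fin 3)) r, M < ‖V t x‖) →
      ∀ c : ℝ, 0 < c →
      ENNReal.ofReal (η * c ^ 5) ≤ volume {p : ℝ × EuclideanSpace ℝ (Fin 3) |
        p.1 ∈ Icc (-c ^ 2) (-(ε * c ^ 2)) ∧
        ⟪curl (V p.1) p.2, curl (V p.1) p.2⟫ < (-p.1) * (⟪curl (V p.1) p.2,
          fderiv ℝ (V p.1) p.2 (curl (V p.1) p.2)⟫ - frobeniusNormSq (fderiv ℝ (curl (V p.1)) p.2))} := by
  obtain ⟨ε, hε, hε1, η, hη, h⟩ := superCaloric_volume C K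
  refine ⟨ε, hε, hε1, η, hη, fun V hV hlaw hsing c hc => ?_⟩
  have h1 := h (nsRescale c V) (hV.nsRescale hc) (dissipationLaw_nsRescale hlaw hc)
    (singularAtOrigin_nsRescale hsing hc)
  have h2 := volume_window_scaled
    (G := fun F s y => (-s) * (⟪curl (F s) y, fderiv ℝ (F s) y (curl (F s) y)⟫
        - 1 * frobeniusNormSq (fderiv ℝ (curl (F s)) y)) ≤ ⟪curl (F s) y, curl (F s) y⟫)
    (fun F c' s y hc' _ hG => critProd_at_nsRescale F 1 y hc' hG) hε hc (V := V) (η := η)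
    (h1.trans (measure_mono fun p hp => ⟨hp.1, by
      have := hp.2; rw [one_mul]; exact not_le.2 this⟩))
  refine h2.trans (measure_mono fun p hp => ⟨hp.1, ?_⟩)
  have := hp.2
  rw [one_mul] at this
  exact not_le.1 this

end Scaled

/-! ### Temporal densities -/

section Times

/-- **A subset of the window whose points lie in the gradient core is contained in
(its time projection) × B(0, R c).** [folklore] -/
theorem subset_times_prod_ball' {c ε R : ℝ} (hc : 0 < c) (hR : 0 ≤ R)
    {S : Set (ℝ × EuclideanSpace ℝ (Fin 3))}
    (hS : ∀ p ∈ S, p.1 ∈ Icc (-c ^ 2) (-(ε * c ^ 2)) ∧ ‖p.2‖ < R * Real.sqrt (-p.1)) :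
    S ⊆ {t : ℝ | ∃ x : EuclideanSpace ℝ (Fin 3), (t, x) ∈ S} ×ˢ
      ball (0 : EuclideanSpace ℝ (Fin 3)) (R * c) := by
  intro p hp
  obtain ⟨hp1, hp2⟩ := hS p hp
  refine ⟨⟨p.2, hp⟩, ?_⟩
  rw [mem_ball_zero_iff]
  refine hp2.trans_le (mul_le_mul_of_nonneg_left ?_ hR)
  have h1 : -p.1 ≤ c ^ 2 := by linarith [hp1.1]
  calc Real.sqrt (-p.1) ≤ Real.sqrt (c ^ 2) := Real.sqrt_le_sqrt h1
    _ = c := Real.sqrt_sq hc.le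

/-- **Cavalieri with a given constant**: `ofReal (η c⁵) ≤ vol(S)`, `S ⊆ T ×ˢ B(0, R c)` with `R > 0`
give `ofReal ((η/(R³ b₃)) c²) ≤ vol(T)`, `b₃ = vol B(0,1)`. [folklore] -/
theorem measure_times_ge_of_volume {S : Set (ℝ × EuclideanSpace ℝ (Fin 3))} {T : Set ℝ}
    {R η c : ℝ} (hR : 0 < R) (hη : 0 < η) (hc : 0 < c)
    (hsub : S ⊆ T ×ˢ ball (0 : EuclideanSpace ℝ (Fin 3)) (R * c))
    (hvol : ENNReal.ofReal (η * c ^ 5) ≤ volume S) :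
    ENNReal.ofReal (η / (R ^ 3 * (volume (ball (0 : EuclideanSpace ℝ (Fin 3)) 1)).toReal) * c ^ 2) ≤
      volume T := by
  set b₃ : ℝ := (volume (ball (0 : EuclideanSpace ℝ (Fin 3)) 1)).toReal with hb₃
  have hb₃pos : 0 < b₃ :=
    ENNReal.toReal_pos (measure_ball_pos volume _ one_pos).ne' measure_ball_lt_top.ne
  have hRc : 0 < R * c := by positivity
  have key := measure_times_mul_ge hRc hsub hvol
  have hD : 0 < (R * c) ^ 3 * b₃ := by positivity
  have e : η * c ^ 5 = η / (R ^ 3 * b₃) * c ^ 2 * ((R * c) ^ 3 * b₃) := by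
    field_simp
  rw [e, ENNReal.ofReal_mul (by positivity)] at key
  have hfin : ENNReal.ofReal ((R * c) ^ 3 * b₃) ≠ 0 := by
    rw [ne_eq, ENNReal.ofReal_eq_zero, not_le]; exact hD
  exact (ENNReal.mul_le_mul_iff_left hfin ENNReal.ofReal_ne_top).1 key

/-- **THE STRETCHING-EXCESS INSTANTS HAVE DEFINITE TEMPORAL DENSITY.** For every `A` there are
`ε(A) ∈ (0,1)`, `κ(A) > 0` such that for every SINGULAR KNSS-gauge Type-I field
(`IsTypeIAncientMild C V`, `C ≤ A`) with a Type-I envelope `HasTypeIDecay A V` and every `c > 0`,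
the instants `t ∈ [−c², −εc²]` at which SOME point has `|∇ω|²_F + ‖ω‖²/(4(−t)) < ⟪ω, ∇V ω⟫` form
a set of measure `≥ κ c²`. [folklore (Cavalieri) + KNSS compactness; cite: KochNadirashviliSereginSverak2009, §4 (arXiv:0709.3599 p. 8)] -/
theorem stretchingTimes_measure_ge (A : ℝ) : ∃ ε : ℝ, 0 < ε ∧ ε < 1 ∧ ∃ κ : ℝ, 0 < κ ∧
    ∀ (C : ℝ) (V : ℝ → EuclideanSpace ℝ (Fin 3) → EuclideanSpace ℝ (Fin 3)),
      IsTypeIAncientMild C V → C ≤ A → HasTypeIDecay A V →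
      (∀ r > 0, ∀ M : ℝ, ∃ t ∈ Ioo (-(r ^ 2)) (0 : ℝ),
        ∃ x ∈ ball (0 : EuclideanSpace ℝ (Fin 3)) r, M < ‖V t x‖) →
      ∀ c : ℝ, 0 < c →
      ENNReal.ofReal (κ * c ^ 2) ≤ volume {t : ℝ | t ∈ Icc (-c ^ 2) (-(ε * c ^ 2)) ∧
        ∃ x : EuclideanSpace ℝ (Fin 3),
          frobeniusNormSq (fderiv ℝ (curl (V t)) x) + ‖curl (V t) x‖ ^ 2 / (4 * (-t)) <
            ⟪curl (V t) x, fderiv ℝ (V t) x (curl (V t) x)⟫} := by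
  obtain ⟨ε, hε, hε1, η, hη, h⟩ := stretching_excess_volume_scaled A
  obtain ⟨K₁, hK₁0, hK₁⟩ :=
    IsTypeIAncientMild.exists_forall_pow_mul_norm_iteratedFDeriv_le_of_hasTypeIDecay 1 A
  -- the gradient core radius for the threshold `¼`: `√(4K₁) − 1`, enlarged to be `≥ 1`
  set R : ℝ := max (Real.sqrt (K₁ / (1 / 4)) - 1) 1 with hR
  have hRpos : 0 < R := lt_of_lt_of_le one_pos (le_max_right _ _)
  refine ⟨ε, hε, hε1, η / (R ^ 3 * (volume (ball (0 : EuclideanSpace ℝ (Fin 3)) 1)).toReal), ?_,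
    fun C V hV hCA hdec hsing c hc => ?_⟩
  · have hb : 0 < (volume (ball (0 : EuclideanSpace ℝ (Fin 3)) 1)).toReal :=
      ENNReal.toReal_pos (measure_ball_pos volume _ one_pos).ne' measure_ball_lt_top.ne
    positivity
  have hV' : IsTypeIAncientMild A V := isTypeIAncientMild_of_le hV hCA
  set S : Set (ℝ × EuclideanSpace ℝ (Fin 3)) := {p | p.1 ∈ Icc (-c ^ 2) (-(ε * c ^ 2)) ∧
    frobeniusNormSq (fderiv ℝ (curl (V p.1)) p.2) + ‖curl (V p.1) p.2‖ ^ 2 / (4 * (-p.1)) <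
      ⟪curl (V p.1) p.2, fderiv ℝ (V p.1) p.2 (curl (V p.1) p.2)⟫} with hSdef
  have hvol : ENNReal.ofReal (η * c ^ 5) ≤ volume S := h C V hV hCA hdec hsing c hc
  have hcore : ∀ p ∈ S, p.1 ∈ Icc (-c ^ 2) (-(ε * c ^ 2)) ∧ ‖p.2‖ < R * Real.sqrt (-p.1) := by
    intro p hp
    obtain ⟨hp1, hp2⟩ := hp
    have ht : p.1 < 0 := by
      have : 0 < ε * c ^ 2 := by positivity
      linarith [hp1.2]
    refine ⟨hp1, ?_⟩
    have hg := gradFast_of_stretching_excess ht hp2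
    have hK := hK₁ hV' hdec p.1 ht p.2
    rw [norm_iteratedFDeriv_one] at hK
    have h1 := norm_lt_of_gradFast (by norm_num : (0:ℝ) < 1 / 4) ht hK hg
    exact h1.trans_le (mul_le_mul_of_nonneg_right (le_max_left _ _) (Real.sqrt_nonneg _))
  have hsub := subset_times_prod_ball' hc hRpos.le hcore
  have key := measure_times_ge_of_volume hRpos hη hc hsub hvol
  refine key.trans (measure_mono fun t ht => ?_)
  obtain ⟨x, hx⟩ := ht
  exact ⟨hx.1, x, hx.2⟩

/-- **THE SUPER-CALORIC INSTANTS OF `t²‖ω‖²` HAVE DEFINITE TEMPORAL DENSITY (critical element).**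
For every `A, K` there are `ε ∈ (0,1)`, `κ > 0` such that for every SINGULAR member of the stratum
with a Type-I envelope (`IsTypeIAncientMild C V`, `C ≤ A`, `HasTypeIDecay A V`, law `K`) and every
`c > 0`, the instants `t ∈ [−c², −εc²]` at which SOME point has
`‖ω‖² < (−t)(⟪ω, ∇V ω⟫ − |∇ω|²_F)` form a set of measure `≥ κ c²`.
[folklore (Cavalieri) + KNSS compactness; cite: KochNadirashviliSereginSverak2009, §4 (arXiv:0709.3599 p. 8)] -/
theorem superCaloricTimes_measure_ge (A K : ℝ) : ∃ ε : ℝ, 0 < ε ∧ ε < 1 ∧ ∃ κ : ℝ, 0 < κ ∧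
    ∀ (C : ℝ) (V : ℝ → EuclideanSpace ℝ (Fin 3) → EuclideanSpace ℝ (Fin 3)),
      IsTypeIAncientMild C V → C ≤ A → HasTypeIDecay A V →
      (∀ s : ℝ, s < 0 → ∫⁻ x, ‖fderiv ℝ (V s) x‖ₑ ^ 2 ≤ ENNReal.ofReal (K / Real.sqrt (-s))) →
      (∀ r > 0, ∀ M : ℝ, ∃ t ∈ Ioo (-(r ^ 2)) (0 : ℝ),
        ∃ x ∈ ball (0 : EuclideanSpace ℝ (Fin 3)) r, M < ‖V t x‖) →
      ∀ c : ℝ, 0 < c →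
      ENNReal.ofReal (κ * c ^ 2) ≤ volume {t : ℝ | t ∈ Icc (-c ^ 2) (-(ε * c ^ 2)) ∧
        ∃ y : EuclideanSpace ℝ (Fin 3),
          ⟪curl (V t) y, curl (V t) y⟫ < (-t) * (⟪curl (V t) y, fderiv ℝ (V t) y (curl (V t) y)⟫
            - frobeniusNormSq (fderiv ℝ (curl (V t)) y))} := by
  obtain ⟨ε, hε, hε1, η, hη, h⟩ := superCaloric_volume_scaled A K
  obtain ⟨K₁, hK₁0, hK₁⟩ :=
    IsTypeIAncientMild.exists_forall_pow_mul_norm_iteratedFDeriv_le_of_hasTypeIDecay 1 A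
  set R : ℝ := max (Real.sqrt (K₁ / 1) - 1) 1 with hR
  have hRpos : 0 < R := lt_of_lt_of_le one_pos (le_max_right _ _)
  refine ⟨ε, hε, hε1, η / (R ^ 3 * (volume (ball (0 : EuclideanSpace ℝ (Fin 3)) 1)).toReal), ?_,
    fun C V hV hCA hdec hlaw hsing c hc => ?_⟩
  · have hb : 0 < (volume (ball (0 : EuclideanSpace ℝ (Fin 3)) 1)).toReal :=
      ENNReal.toReal_pos (measure_ball_pos volume _ one_pos).ne' measure_ball_lt_top.ne
    positivity
  have hV' : IsTypeIAncientMild A V := isTypeIAncientMild_of_le hV hCA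
  set S : Set (ℝ × EuclideanSpace ℝ (Fin 3)) := {p | p.1 ∈ Icc (-c ^ 2) (-(ε * c ^ 2)) ∧
    ⟪curl (V p.1) p.2, curl (V p.1) p.2⟫ < (-p.1) * (⟪curl (V p.1) p.2,
      fderiv ℝ (V p.1) p.2 (curl (V p.1) p.2)⟫ - frobeniusNormSq (fderiv ℝ (curl (V p.1)) p.2))}
    with hSdef
  have hvol : ENNReal.ofReal (η * c ^ 5) ≤ volume S := h V hV' hlaw hsing c hc
  have hcore : ∀ p ∈ S, p.1 ∈ Icc (-c ^ 2) (-(ε * c ^ 2)) ∧ ‖p.2‖ < R * Real.sqrt (-p.1) := by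
    intro p hp
    obtain ⟨hp1, hp2⟩ := hp
    have ht : p.1 < 0 := by
      have : 0 < ε * c ^ 2 := by positivity
      linarith [hp1.2]
    refine ⟨hp1, ?_⟩
    have hg := gradFast_of_superCaloric ht hp2
    have hK := hK₁ hV' hdec p.1 ht p.2
    rw [norm_iteratedFDeriv_one] at hK
    have h1 := norm_lt_of_gradFast one_pos ht hK hg
    exact h1.trans_le (mul_le_mul_of_nonneg_right (le_max_left _ _) (Real.sqrt_nonneg _))
  have hsub := subset_times_prod_ball' hc hRpos.le hcore
  have key := measure_times_ge_of_volume hRpos hη hc hsub hvol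
  refine key.trans (measure_mono fun t ht => ?_)
  obtain ⟨x, hx⟩ := ht
  exact ⟨hx.1, x, hx.2⟩

end Times

end Summit.NavierStokesRegularity.NavierStokesRegularity.Theorems.FiniteDissipationLiouville.WindowRecurrence

end
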